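import Mathlib.Analysis.Calculus.InverseFunctionTheorem.Deriv
import Mathlib.Analysis.Complex.RemovableSingularity
import Mathlib.Analysis.Complex.Liouville
import Literature.NumberTheory.Automorphic.ModularLambdaCovering
import Literature.NumberTheory.Automorphic.ModularLambdaDeriv
import HarnessLib

/-!
# Descent through `λ`: `Γ(2)`-invariant holomorphic functions are functions of `λ`, and
# holomorphic modular functions of weight `0` for `Γ(2)` bounded at the cusps are constant

Sequel on the modular `λ`-function. With the Hauptmodul theorem
(`ModularLambdaCovering.lean`: `λ(z₁) = λ(z₂) ↔ z₂ ∈ Γ(2)z₁`), surjectivity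
(`ModularLambdaSurjective.lean`: `λ(ℍ) = ℂ ∖ {0,1}`) and `λ' ≠ 0` (`ModularLambdaDeriv.lean`) we
prove the two statements that make `λ` a coordinate on `Y(2) = ℍ/Γ(2)` for FUNCTION THEORY —
the analytic content of "`M_2 = ℚ(λ)`" / "the holomorphic modular forms on `Y(2)` are given by
`ℚ(λ^{±1}, (1 − λ)^{±1})`" in Calegari–Dimitrov–Tang (F. Calegari, V. Dimitrov, Y. Tang,
*The unbounded denominators conjecture*, J. Amer. Math. Soc. **38** (2025), arXiv:2109.09040,
§1 p. 3 and §4.2, Definition 22 and the sentence following it):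

* **`exists_factor_of_Gamma_two_invariant`** — every holomorphic `F : ℍ → ℂ` invariant under
  `Γ(2)` is `G ∘ λ` for a (unique) `G` HOLOMORPHIC on `ℂ ∖ {0, 1}` (descent: `G(w) = F(τ)` for any
  `τ` with `λ(τ) = w`, well defined by the Hauptmodul theorem, holomorphic by the local inverses of
  `λ`, `λ' ≠ 0`);
* `norm_factor_le_near_zero` — if moreover `F` is bounded high in the upper half-plane then `G` is
  bounded near `0` (small values of `λ` on the fundamental domain only occur high up:
  `closure_image_modularLambda_fd_subset` and the anharmonic six);
* **`Gamma_two_invariant_eq_const_of_bounded`** — a `Γ(2)`-invariant holomorphic function on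
  `ℍ` which is bounded at the three cusps `∞, 0, 1` (i.e. `F(τ)`, `F(−1/τ)`, `F(1 − 1/τ)`
  bounded for `Im τ ≫ 0`) is CONSTANT: its factor `G` is bounded near `0`, `1`, `∞` (the same
  lemma applied to `F`, `F ∘ S`, `F ∘ TS`, whose factors are `G(w)`, `G(1 − w)`, `G(1 − w⁻¹)`),
  hence extends to a bounded entire function (removable singularities), constant by Liouville.
  In particular `M₀(Γ(2)) = ℂ`.

No definitions, no named facts.

## References

* L. V. Ahlfors, *Complex Analysis*, 3rd ed., Ch. 7 §3.4–3.5; F. Diamond, J. Shurman, *A First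
  Course in Modular Forms*, §3.5–3.6 (modular functions of level `2`, `ℂ(X(2)) = ℂ(λ)`).
* [CalegariDimitrovTang2025] arXiv:2109.09040, §1 p. 3 (`M_2 = ℚ(λ)`), §4.2 Definition 22 and
  the following sentence (`H⁰(Y(2), 𝒪) = ℚ[λ^{±1}, (1−λ)^{±1}]`).
-/

noncomputable section

open Complex Filter Topology Function Metric Set
open UpperHalfPlane hiding I
open scoped Real Topology MatrixGroups Modular

namespace Literature.NumberTheory.Automorphic

namespace ModularLambda

open Literature.NumberTheory.EllipticCurves.JacobiThetaNull
open CongruenceSubgroup ModularGroup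

/-! ### Descent of `Γ(2)`-invariant holomorphic functions through `λ` -/

/-- `λ` has a non-zero STRICT derivative on `ℍ` (it is analytic). [folklore] -/
theorem hasStrictDerivAt_modularLambda {τ : ℂ} (hτ : 0 < im τ) :
    HasStrictDerivAt modularLambda (deriv modularLambda τ) τ := by
  have hopen : IsOpen {z : ℂ | 0 < z.im} := isOpen_lt continuous_const Complex.continuous_im
  have han : AnalyticAt ℂ modularLambda τ :=
    differentiableOn_modularLambda.analyticAt (hopen.mem_nhds hτ)
  exact han.contDiffAt.hasStrictDerivAt one_ne_zero

/-- **Descent through `λ`.** A holomorphic function on the upper half-plane invariant under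
`Γ(2)` is `G ∘ λ` for some `G` holomorphic on `ℂ ∖ {0, 1}`: `G(w) := F(τ)` for any `τ` with
`λ(τ) = w` is well defined (`modularLambda_eq_modularLambda_iff`) and holomorphic (compose with a
local holomorphic inverse of `λ`, which exists as `λ' ≠ 0`). [folklore]
(cf. [CalegariDimitrovTang2025, §1 p. 3]: "`f` is then an algebraic function of `λ`".) -/
theorem exists_factor_of_Gamma_two_invariant {F : ℂ → ℂ}
    (hF : DifferentiableOn ℂ F {z : ℂ | 0 < z.im})
    (hinv : ∀ γ ∈ CongruenceSubgroup.Gamma 2, ∀ z : ℍ, F ((γ • z : ℍ) : ℂ) = F z) :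
    ∃ G : ℂ → ℂ, DifferentiableOn ℂ G ({0, 1}ᶜ : Set ℂ) ∧
      ∀ τ : ℂ, 0 < τ.im → F τ = G (modularLambda τ) := by
  classical
  -- a section of `λ` over `ℂ ∖ {0,1}`
  have hsec : ∀ w : ℂ, ∃ τ : ℂ, (w ≠ 0 ∧ w ≠ 1) → 0 < im τ ∧ modularLambda τ = w := by
    intro w
    by_cases hw : w ≠ 0 ∧ w ≠ 1
    · obtain ⟨τ, hτ, hτw⟩ := exists_modularLambda_eq hw.1 hw.2
      exact ⟨τ, fun _ ↦ ⟨hτ, hτw⟩⟩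
    · exact ⟨0, fun h ↦ absurd h hw⟩
  choose sec hsec using hsec
  refine ⟨fun w ↦ F (sec w), ?_, ?_⟩
  swap
  · -- the factorisation `F = G ∘ λ`
    intro τ hτ
    have hw : modularLambda τ ≠ 0 ∧ modularLambda τ ≠ 1 :=
      ⟨modularLambda_ne_zero hτ, modularLambda_ne_one hτ⟩
    obtain ⟨hσ, hσw⟩ := hsec (modularLambda τ) hw
    -- `sec (λ τ)` and `τ` have the same `λ`, hence are `Γ(2)`-equivalent
    have h := (modularLambda_eq_modularLambda_iff (z₁ := ⟨sec (modularLambda τ), hσ⟩)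
      (z₂ := ⟨τ, hτ⟩)).mp hσw
    obtain ⟨γ, hγ, hγτ⟩ := h
    have := hinv γ hγ ⟨sec (modularLambda τ), hσ⟩
    rw [hγτ] at this
    exact this
  · -- holomorphy on `ℂ ∖ {0,1}`
    intro w₀ hw₀
    simp only [mem_compl_iff, mem_insert_iff, mem_singleton_iff, not_or] at hw₀
    obtain ⟨hτ₀, hτ₀w⟩ := hsec w₀ hw₀
    set τ₀ := sec w₀ with hτ₀def
    have hsd := hasStrictDerivAt_modularLambda hτ₀
    have hne := deriv_modularLambda_ne_zero hτ₀
    set ψ := hsd.localInverse modularLambda _ τ₀ hne with hψ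
    have hψd : HasStrictDerivAt ψ (deriv modularLambda τ₀)⁻¹ (modularLambda τ₀) :=
      hsd.to_localInverse hne
    have hright : ∀ᶠ y in 𝓝 (modularLambda τ₀), modularLambda (ψ y) = y :=
      hsd.eventually_right_inverse hne
    have hψlim : Tendsto ψ (𝓝 (modularLambda τ₀)) (𝓝 τ₀) :=
      HasStrictFDerivAt.localInverse_tendsto _
    have hψpos : ∀ᶠ y in 𝓝 (modularLambda τ₀), 0 < im (ψ y) :=
      hψlim ((isOpen_lt continuous_const Complex.continuous_im).mem_nhds hτ₀)
    rw [hτ₀w] at hψd hright hψpos hψlim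
    -- near `w₀`, `G = F ∘ ψ`
    have heq : (fun w ↦ F (sec w)) =ᶠ[𝓝 w₀] fun w ↦ F (ψ w) := by
      filter_upwards [hright, hψpos] with y hy hypos
      -- both `sec y` and `ψ y` are preimages of `y` in `ℍ`
      have hy01 : y ≠ 0 ∧ y ≠ 1 := by
        rw [← hy]
        exact ⟨modularLambda_ne_zero hypos, modularLambda_ne_one hypos⟩
      obtain ⟨hsy, hsyw⟩ := hsec y hy01
      have h := (modularLambda_eq_modularLambda_iff (z₁ := ⟨sec y, hsy⟩)
        (z₂ := ⟨ψ y, hypos⟩)).mp (by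
          show modularLambda (sec y) = modularLambda (ψ y)
          rw [hsyw, hy])
      obtain ⟨γ, hγ, hγτ⟩ := h
      have := hinv γ hγ ⟨sec y, hsy⟩
      rw [hγτ] at this
      exact this.symm
    refine (heq.differentiableAt_iff.mpr ?_).differentiableWithinAt
    have hFd : DifferentiableAt ℂ F (ψ w₀) := by
      have hψ0 : ψ w₀ = τ₀ := by
        have := (hsd.eventually_left_inverse hne).self_of_nhds
        rwa [hτ₀w] at this
      rw [hψ0]
      exact hF.differentiableAt ((isOpen_lt continuous_const Complex.continuous_im).mem_nhds hτ₀)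
    exact hFd.comp w₀ hψd.hasDerivAt.differentiableAt

/-! ### Quantitative facts about `λ` on the fundamental domain -/

/-- On the fundamental domain `D`, `λ` is bounded, bounded away from `1`, and small only high
up: for every `B` there is `ε > 0` with `‖λ z‖ < ε, z ∈ D ⟹ Im z > B`; moreover `‖λ‖ ≤ R` and
`η ≤ ‖λ − 1‖` on `D` for some `R, η > 0`. [folklore] -/
theorem modularLambda_fd_bounds (B : ℝ) :
    ∃ ε > 0, ∃ R > 0, ∃ η > 0, ∀ z : ℂ, 0 < z.im → 1 ≤ normSq z → |z.re| ≤ 1 / 2 →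
      (‖modularLambda z‖ < ε → B < z.im) ∧ ‖modularLambda z‖ ≤ R ∧
        η ≤ ‖modularLambda z - 1‖ := by
  set D : Set ℂ := {z : ℂ | 0 < z.im ∧ 1 ≤ normSq z ∧ |z.re| ≤ 1 / 2} with hD
  -- (1) `1 ∉ closure (λ(D))` and `λ(D) ∌ 1`: distance `η`
  have h1 : (1 : ℂ) ∉ closure (modularLambda '' D) := by
    intro h
    rcases closure_image_modularLambda_fd_subset h with ⟨z, hz, hz1⟩ | h0
    · exact modularLambda_ne_one hz.1 hz1
    · exact one_ne_zero (mem_singleton_iff.mp h0)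
  rw [Metric.mem_closure_iff] at h1
  push Not at h1
  obtain ⟨η, hη, hηD⟩ := h1
  -- (2) high up, `λ` is small; below, `D` is compact
  obtain ⟨B₀, hB₀⟩ := exists_forall_norm_modularLambda_lt one_pos
  set B' : ℝ := max (max B B₀) 1 with hB'
  set K : Set ℂ := {z : ℂ | 1 / 2 ≤ z.im ∧ z.im ≤ B' ∧ 1 ≤ normSq z ∧ |z.re| ≤ 1 / 2} with hK
  have hKc : IsCompact K := by
    refine Metric.isCompact_of_isClosed_isBounded ?_ ?_
    · simp only [hK, Set.setOf_and]
      exact (isClosed_le continuous_const Complex.continuous_im).inter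
        ((isClosed_le Complex.continuous_im continuous_const).inter
          ((isClosed_le continuous_const Complex.continuous_normSq).inter
            (isClosed_le (continuous_abs.comp Complex.continuous_re) continuous_const)))
    · rw [Metric.isBounded_iff_subset_closedBall 0]
      refine ⟨B' + 1, fun z hz ↦ ?_⟩
      rw [mem_closedBall_zero_iff]
      have h1 := norm_le_abs_re_add_abs_im z
      have h2 : |z.im| = z.im := abs_of_pos (by linarith [hz.1])
      linarith [hz.2.1, hz.2.2.2]
  have hKpos : ∀ z ∈ K, 0 < z.im := fun z hz ↦ by linarith [hz.1]
  have hcont : ContinuousOn (fun z ↦ ‖modularLambda z‖) K :=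
    (continuousOn_modularLambda.mono fun z hz ↦ hKpos z hz).norm
  -- `‖λ‖` attains a positive minimum and a maximum on the compact `K` (if non-empty)
  have hlow : ∃ ε > 0, ∀ z ∈ K, ε ≤ ‖modularLambda z‖ := by
    rcases K.eq_empty_or_nonempty with hKe | hKne
    · exact ⟨1, one_pos, fun z hz ↦ by simp [hKe] at hz⟩
    · obtain ⟨z₀, hz₀, hmin⟩ := hKc.exists_isMinOn hKne hcont
      refine ⟨‖modularLambda z₀‖, norm_pos_iff.mpr (modularLambda_ne_zero (hKpos z₀ hz₀)),
        fun z hz ↦ hmin hz⟩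
  have hhigh : ∃ R > 0, ∀ z ∈ K, ‖modularLambda z‖ ≤ R := by
    rcases K.eq_empty_or_nonempty with hKe | hKne
    · exact ⟨1, one_pos, fun z hz ↦ by simp [hKe] at hz⟩
    · obtain ⟨z₀, hz₀, hmax⟩ := hKc.exists_isMaxOn hKne hcont
      exact ⟨‖modularLambda z₀‖ + 1, by positivity, fun z hz ↦ (hmax hz).trans (by linarith)⟩
  obtain ⟨ε, hε, hεK⟩ := hlow
  obtain ⟨R, hR, hRK⟩ := hhigh
  -- the half-plane bound `1/2 ≤ Im` on `D`
  have half_le : ∀ z : ℂ, 0 < z.im → 1 ≤ normSq z → |z.re| ≤ 1 / 2 → 1 / 2 ≤ z.im := by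
    intro z h0 h1 h2
    rw [Complex.normSq_apply] at h1
    obtain ⟨h2a, h2b⟩ := abs_le.mp h2
    nlinarith
  refine ⟨ε, hε, max R 1, by positivity, η, hη, fun z h0 h1 h2 ↦ ⟨fun hsmall ↦ ?_, ?_, ?_⟩⟩
  · -- small value ⇒ not in `K` ⇒ high
    by_contra hle
    have hzK : z ∈ K := ⟨half_le z h0 h1 h2, (not_lt.mp hle).trans (by simp [hB']), h1, h2⟩
    exact absurd (hεK z hzK) (not_le.mpr hsmall)
  · by_cases hzB : z.im ≤ B'
    · exact (hRK z ⟨half_le z h0 h1 h2, hzB, h1, h2⟩).trans (le_max_left _ _)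
    · have : ‖modularLambda z‖ < 1 :=
        hB₀ z (((le_max_right _ _).trans (le_max_left _ _)).trans (not_le.mp hzB).le)
      exact this.le.trans (le_max_right _ _)
  · have := hηD (modularLambda z) ⟨z, ⟨h0, h1, h2⟩, rfl⟩
    rwa [dist_comm, dist_eq_norm] at this

/-! ### Boundedness of the factor near `0` -/

/-- **If `F = G ∘ λ` on `ℍ` and `F` is bounded high in the upper half-plane, then `G` is bounded
near `0`.** Every `w ≠ 0, 1` is `λ(τ)` with `τ = g⁻¹ z`, `z` in the fundamental domain of
`SL(2, ℤ)`, and `w` is one of the anharmonic six of `x = λ(z)`; for `w` small only `w = x` and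
`w = x/(x − 1) = λ(z + 1)` are possible, both with `z` high up. [folklore] -/
theorem norm_factor_le_near_zero {F G : ℂ → ℂ}
    (hFG : ∀ τ : ℂ, 0 < τ.im → F τ = G (modularLambda τ))
    (hbd : ∃ B M : ℝ, ∀ τ : ℂ, B ≤ τ.im → ‖F τ‖ ≤ M) :
    ∃ δ > 0, ∃ M : ℝ, ∀ w : ℂ, ‖w‖ < δ → w ≠ 0 → w ≠ 1 → ‖G w‖ ≤ M := by
  obtain ⟨B, M, hBM⟩ := hbd
  obtain ⟨ε, hε, R, hR, η, hη, hD⟩ := modularLambda_fd_bounds B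
  have hR1 : 0 < R + 1 := by linarith
  refine ⟨min (min (1 / 2) (η / 2)) (min (1 / (R + 1)) (ε / (R + 1))), by positivity, M,
    fun w hw hw0 hw1 ↦ ?_⟩
  have hw_half : ‖w‖ < 1 / 2 := lt_of_lt_of_le hw ((min_le_left _ _).trans (min_le_left _ _))
  have hw_eta : ‖w‖ < η / 2 := lt_of_lt_of_le hw ((min_le_left _ _).trans (min_le_right _ _))
  have hw_R : ‖w‖ < 1 / (R + 1) := lt_of_lt_of_le hw ((min_le_right _ _).trans (min_le_left _ _))
  have hw_eps : ‖w‖ < ε / (R + 1) :=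
    lt_of_lt_of_le hw ((min_le_right _ _).trans (min_le_right _ _))
  -- a preimage, moved to the fundamental domain
  obtain ⟨τ, hτ, hτw⟩ := exists_modularLambda_eq hw0 hw1
  obtain ⟨g, hg⟩ := ModularGroup.exists_smul_mem_fd ⟨τ, hτ⟩
  set z : ℍ := g • ⟨τ, hτ⟩ with hz
  have hz0 : 0 < im (z : ℂ) := z.2
  obtain ⟨hzε, hzR, hzη⟩ := hD z hz0 hg.1 hg.2
  have hx0 : modularLambda (z : ℂ) ≠ 0 := modularLambda_ne_zero hz0
  have hx1 : modularLambda (z : ℂ) - 1 ≠ 0 := sub_ne_zero.mpr (modularLambda_ne_one hz0)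
  have hcoe : τ = ((g⁻¹ • z : ℍ) : ℂ) := by rw [hz, inv_smul_smul]
  have h6 := modularLambda_smul_eq_or g⁻¹ z
  rw [← hcoe, hτw] at h6
  have hF_high : ∀ σ : ℂ, B < σ.im → ‖F σ‖ ≤ M := fun σ hσ ↦ hBM σ hσ.le
  have hεle : ε / (R + 1) ≤ ε := div_le_self hε.le (by linarith)
  -- the anharmonic six
  rcases h6 with h | h | h | h | h | h
  · -- `w = x`: `z` is high
    rw [h, ← hFG _ hz0]
    exact hF_high _ (hzε (by rw [← h]; linarith))
  · -- `w = 1 - x`: impossible, `‖1 - x‖ ≥ η`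
    exfalso
    rw [h, norm_sub_rev] at hw_eta
    linarith
  · -- `w = x⁻¹`: impossible, `‖x‖ ≤ R`
    exfalso
    rw [h, norm_inv, one_div] at hw_R
    have hxpos : 0 < ‖modularLambda (z : ℂ)‖ := norm_pos_iff.mpr hx0
    have := (inv_lt_inv₀ hxpos hR1).mp hw_R
    linarith
  · -- `w = (1 - x)⁻¹`: impossible
    exfalso
    rw [h, norm_inv, one_div] at hw_R
    have h1x : 0 < ‖1 - modularLambda (z : ℂ)‖ :=
      norm_pos_iff.mpr (fun h' ↦ hx1 (by linear_combination -h'))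
    have := (inv_lt_inv₀ h1x hR1).mp hw_R
    have : ‖1 - modularLambda (z : ℂ)‖ ≤ 1 + ‖modularLambda (z : ℂ)‖ :=
      (norm_sub_le _ _).trans (by rw [norm_one])
    linarith
  · -- `w = 1 - x⁻¹`: impossible, forces `x` near `1`
    exfalso
    rw [h] at hw_eta hw_half
    have hxpos : 0 < ‖modularLambda (z : ℂ)‖ := norm_pos_iff.mpr hx0
    have hxinv : 1 / 2 ≤ ‖(modularLambda (z : ℂ))⁻¹‖ := by
      have := norm_sub_norm_le (1 : ℂ) (1 - (modularLambda (z : ℂ))⁻¹)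
      rw [sub_sub_cancel, norm_one] at this
      linarith
    have hxle : ‖modularLambda (z : ℂ)‖ ≤ 2 := by
      rw [norm_inv, le_inv_comm₀ (by norm_num) hxpos] at hxinv
      linarith
    have hkey : ‖modularLambda (z : ℂ) - 1‖ =
        ‖modularLambda (z : ℂ)‖ * ‖1 - (modularLambda (z : ℂ))⁻¹‖ := by
      rw [← norm_mul, mul_sub, mul_one, mul_inv_cancel₀ hx0]
    have : ‖modularLambda (z : ℂ)‖ * ‖1 - (modularLambda (z : ℂ))⁻¹‖ < η :=
      calc ‖modularLambda (z : ℂ)‖ * ‖1 - (modularLambda (z : ℂ))⁻¹‖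
          ≤ 2 * ‖1 - (modularLambda (z : ℂ))⁻¹‖ := by gcongr
        _ < 2 * (η / 2) := by gcongr
        _ = η := by ring
    linarith
  · -- `w = 1 - (1 - x)⁻¹ = λ(T z) = λ(z + 1)`: `z` is high
    rw [h, ← modularLambda_T_smul, ← hFG _ (ModularGroup.T • z).2]
    have him : ((ModularGroup.T • z : ℍ) : ℂ).im = (z : ℂ).im := by
      rw [modular_T_smul, coe_vadd]
      simp
    refine hF_high _ ?_
    rw [him]
    refine hzε ?_
    -- `‖x‖ < ε` from `‖x/(x-1)‖ < ε/(R+1)` and `‖x - 1‖ ≤ R + 1`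
    rw [h] at hw_eps
    have hx1' : 1 - modularLambda (z : ℂ) ≠ 0 := fun h' ↦ hx1 (by linear_combination -h')
    have hq : 1 - (1 - modularLambda (z : ℂ))⁻¹ =
        modularLambda (z : ℂ) / (modularLambda (z : ℂ) - 1) := by
      field_simp
      ring
    rw [hq, norm_div] at hw_eps
    have hx1pos : 0 < ‖modularLambda (z : ℂ) - 1‖ := norm_pos_iff.mpr hx1
    rw [div_lt_iff₀ hx1pos] at hw_eps
    have hx1le : ‖modularLambda (z : ℂ) - 1‖ ≤ R + 1 :=
      (norm_sub_le _ _).trans (by rw [norm_one]; linarith)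
    calc ‖modularLambda (z : ℂ)‖ < ε / (R + 1) * ‖modularLambda (z : ℂ) - 1‖ := hw_eps
      _ ≤ ε / (R + 1) * (R + 1) := by gcongr
      _ = ε := div_mul_cancel₀ ε hR1.ne'

/-! ### Weight-`0` holomorphic modular functions for `Γ(2)` bounded at the cusps are constant -/

/-- **`M₀(Γ(2)) = ℂ`.** A holomorphic function on the upper half-plane, invariant under `Γ(2)`
and bounded at the three cusps `∞`, `0`, `1` of `Γ(2)` — `F(τ)`, `F(−1/τ)` and `F(1 − 1/τ)`
bounded for `Im τ` large — is constant. Proof: `F = G ∘ λ` (`exists_factor_of_Gamma_two_invariant`)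
with `G` holomorphic on `ℂ ∖ {0,1}` and bounded near `0`, `1`, `∞` (`norm_factor_le_near_zero`
for `F`, `F ∘ S`, `F ∘ TS`, with factors `G(w)`, `G(1 − w)`, `G(1 − w⁻¹)`), so `G` extends to a
bounded entire function (removable singularities) and is constant (Liouville). [folklore]
(Diamond–Shurman §3.5–3.6; cf. [CalegariDimitrovTang2025, §4.2, sentence after Definition 22].) -/
theorem Gamma_two_invariant_eq_const_of_bounded {F : ℂ → ℂ}
    (hF : DifferentiableOn ℂ F {z : ℂ | 0 < z.im})
    (hinv : ∀ γ ∈ CongruenceSubgroup.Gamma 2, ∀ z : ℍ, F ((γ • z : ℍ) : ℂ) = F z)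
    (hinf : ∃ B M : ℝ, ∀ τ : ℂ, B ≤ τ.im → ‖F τ‖ ≤ M)
    (h0 : ∃ B M : ℝ, ∀ τ : ℂ, B ≤ τ.im → ‖F (-1 / τ)‖ ≤ M)
    (h1 : ∃ B M : ℝ, ∀ τ : ℂ, B ≤ τ.im → ‖F (1 - 1 / τ)‖ ≤ M) :
    ∃ c : ℂ, ∀ τ : ℂ, 0 < τ.im → F τ = c := by
  obtain ⟨G, hGd, hFG⟩ := exists_factor_of_Gamma_two_invariant hF hinv
  -- the factors of `F ∘ S` and `F ∘ TS`
  have hFG0 : ∀ τ : ℂ, 0 < τ.im → F (-1 / τ) = G (1 - modularLambda τ) := by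
    intro τ hτ
    have h := hFG _ (ModularGroup.S • (⟨τ, hτ⟩ : ℍ)).2
    rw [modularLambda_S_smul] at h
    rw [← h, modular_S_smul, coe_mk, inv_neg, neg_div, one_div]
  have hFG1 : ∀ τ : ℂ, 0 < τ.im → F (1 - 1 / τ) = G (1 - (modularLambda τ)⁻¹) := by
    intro τ hτ
    have h := hFG _ ((ModularGroup.T * ModularGroup.S) • (⟨τ, hτ⟩ : ℍ)).2
    rw [modularLambda_TS_smul] at h
    rw [← h, mul_smul, modular_T_smul, coe_vadd, modular_S_smul, coe_mk, inv_neg, one_div]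
    push_cast
    rw [sub_eq_add_neg]
  -- bounds near `0`, `1`, `∞`
  obtain ⟨δ₀, hδ₀, M₀, hM₀⟩ := norm_factor_le_near_zero hFG hinf
  obtain ⟨δ₁, hδ₁, M₁, hM₁⟩ := norm_factor_le_near_zero (G := fun w ↦ G (1 - w)) hFG0 h0
  obtain ⟨δ₂, hδ₂, M₂, hM₂⟩ := norm_factor_le_near_zero (G := fun w ↦ G (1 - w⁻¹)) hFG1 h1
  -- `G` is bounded on `ℂ ∖ {0,1}`
  have hGbd : ∃ M : ℝ, ∀ w : ℂ, w ≠ 0 → w ≠ 1 → ‖G w‖ ≤ M := by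
    -- the compact middle region
    set K : Set ℂ := {w : ℂ | δ₀ / 2 ≤ ‖w‖ ∧ δ₁ / 2 ≤ ‖w - 1‖ ∧ ‖w‖ ≤ 2 / δ₂ + 2} with hK
    have hKc : IsCompact K := by
      refine Metric.isCompact_of_isClosed_isBounded ?_ ?_
      · simp only [hK, Set.setOf_and]
        exact (isClosed_le continuous_const continuous_norm).inter
          ((isClosed_le continuous_const (continuous_id.sub continuous_const).norm).inter
            (isClosed_le continuous_norm continuous_const))
      · exact (Metric.isBounded_iff_subset_closedBall 0).mpr
          ⟨2 / δ₂ + 2, fun w hw ↦ mem_closedBall_zero_iff.mpr hw.2.2⟩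
    have hK01 : K ⊆ ({0, 1}ᶜ : Set ℂ) := by
      intro w hw
      simp only [mem_compl_iff, mem_insert_iff, mem_singleton_iff, not_or]
      constructor
      · intro h
        have h' := hw.1
        rw [h, norm_zero] at h'
        linarith
      · intro h
        have h' := hw.2.1
        rw [h, sub_self, norm_zero] at h'
        linarith
    obtain ⟨M₃, hM₃⟩ : ∃ M₃, ∀ w ∈ K, ‖G w‖ ≤ M₃ := by
      have hc : ContinuousOn (fun w ↦ ‖G w‖) K := (hGd.continuousOn.mono hK01).norm
      rcases K.eq_empty_or_nonempty with hKe | hKne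
      · exact ⟨0, fun w hw ↦ by simp [hKe] at hw⟩
      · obtain ⟨w₀, -, hmax⟩ := hKc.exists_isMaxOn hKne hc
        exact ⟨‖G w₀‖, fun w hw ↦ hmax hw⟩
    refine ⟨max (max M₀ M₁) (max M₂ M₃), fun w hw0 hw1 ↦ ?_⟩
    by_cases hA : ‖w‖ < δ₀ / 2
    · exact (hM₀ w (by linarith) hw0 hw1).trans ((le_max_left _ _).trans (le_max_left _ _))
    by_cases hB : ‖w - 1‖ < δ₁ / 2
    · have h := hM₁ (1 - w) (by rw [norm_sub_rev]; linarith) (sub_ne_zero.mpr (Ne.symm hw1))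
        (fun h ↦ hw0 (by linear_combination -h))
      simp only [sub_sub_cancel] at h
      exact h.trans ((le_max_right _ _).trans (le_max_left _ _))
    by_cases hC : 2 / δ₂ + 2 < ‖w‖
    · -- large `w`: `w = 1 - u⁻¹` with `u = (1 - w)⁻¹` small
      have hw1' : 1 - w ≠ 0 := sub_ne_zero.mpr (Ne.symm hw1)
      have hularge : 2 / δ₂ < ‖1 - w‖ := by
        have := norm_sub_norm_le w 1
        rw [norm_one, norm_sub_rev] at this
        linarith
      have hu : ‖(1 - w)⁻¹‖ < δ₂ := by
        rw [norm_inv, inv_lt_comm₀ (norm_pos_iff.mpr hw1') hδ₂]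
        have : δ₂⁻¹ ≤ 2 / δ₂ := by rw [div_eq_mul_inv]; linarith [inv_pos.mpr hδ₂]
        linarith
      have h := hM₂ (1 - w)⁻¹ hu (inv_ne_zero hw1') (by
        intro h
        have : 1 - w = 1 := by rw [← inv_inv (1 - w), h, inv_one]
        exact hw0 (by linear_combination -this))
      simp only [inv_inv, sub_sub_cancel] at h
      exact h.trans ((le_max_left _ _).trans (le_max_right _ _))
    · have hwK : w ∈ K := ⟨not_lt.mp hA, not_lt.mp hB, not_lt.mp hC⟩
      exact (hM₃ w hwK).trans ((le_max_right _ _).trans (le_max_right _ _))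
  obtain ⟨M, hM⟩ := hGbd
  -- remove the singularity at `0`
  set G₁ : ℂ → ℂ := update G 0 (limUnder (𝓝[≠] 0) G) with hG₁
  have hs1 : ({1}ᶜ : Set ℂ) ∈ 𝓝 (0 : ℂ) := isOpen_compl_singleton.mem_nhds (by simp)
  have hdiff01 : ({1}ᶜ : Set ℂ) \ {0} = ({0, 1}ᶜ : Set ℂ) := by
    ext w; simp [not_or, and_comm]
  have hG₁d : DifferentiableOn ℂ G₁ ({1}ᶜ : Set ℂ) := by
    refine differentiableOn_update_limUnder_of_bddAbove hs1 (by rwa [hdiff01]) ⟨M, ?_⟩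
    rintro _ ⟨w, hw, rfl⟩
    rw [hdiff01] at hw
    simp only [mem_compl_iff, mem_insert_iff, mem_singleton_iff, not_or] at hw
    exact hM w hw.1 hw.2
  have hG₁eq : ∀ w : ℂ, w ≠ 0 → G₁ w = G w := fun w hw ↦ by rw [hG₁, update_of_ne hw]
  -- remove the singularity at `1`
  set G₂ : ℂ → ℂ := update G₁ 1 (limUnder (𝓝[≠] 1) G₁) with hG₂
  have hG₂d : Differentiable ℂ G₂ := by
    have h : DifferentiableOn ℂ G₂ univ := by
      refine differentiableOn_update_limUnder_of_bddAbove univ_mem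
        (by rw [← compl_eq_univ_sdiff]; exact hG₁d) ⟨max M ‖G₁ 0‖, ?_⟩
      rintro _ ⟨w, hw, rfl⟩
      rw [← compl_eq_univ_sdiff, mem_compl_iff, mem_singleton_iff] at hw
      simp only [comp_apply]
      rcases eq_or_ne w 0 with rfl | hw0
      · exact le_max_right _ _
      · rw [hG₁eq w hw0]
        exact (hM w hw0 hw).trans (le_max_left _ _)
    exact differentiableOn_univ.mp h
  have hG₂eq : ∀ w : ℂ, w ≠ 0 → w ≠ 1 → G₂ w = G w := fun w hw0 hw1 ↦ by
    rw [hG₂, update_of_ne hw1, hG₁eq w hw0]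
  have hG₂bd : Bornology.IsBounded (range G₂) := by
    rw [Metric.isBounded_iff_subset_closedBall 0]
    refine ⟨max (max M ‖G₂ 0‖) ‖G₂ 1‖, ?_⟩
    rintro _ ⟨w, rfl⟩
    rw [mem_closedBall_zero_iff]
    rcases eq_or_ne w 0 with rfl | hw0
    · exact (le_max_right _ _).trans (le_max_left _ _)
    rcases eq_or_ne w 1 with rfl | hw1
    · exact le_max_right _ _
    rw [hG₂eq w hw0 hw1]
    exact ((hM w hw0 hw1).trans (le_max_left _ _)).trans (le_max_left _ _)
  -- Liouville
  refine ⟨G₂ 2, fun τ hτ ↦ ?_⟩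
  rw [hFG τ hτ, ← hG₂eq _ (modularLambda_ne_zero hτ) (modularLambda_ne_one hτ)]
  exact hG₂d.apply_eq_apply_of_bounded hG₂bd _ _

end ModularLambda

end Literature.NumberTheory.Automorphic

end
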